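import Summits.HubbardSuperconductivity.HubbardSuperconductivity.Theorems.AnisotropyChordTransferFibre3DiagonalRate
import Summits.HubbardSuperconductivity.HubbardSuperconductivity.Theorems.AnisotropyChordTransferFibre3ZSquareWindow

/-!
# Route `AnisotropyChord` / H0 rotor rung: the SHARP periodisation bound on the near-pair window — `|a_L(r;0) − a_∞(r)| ≤ C_r/L²`, `|r|∞ ≤ 5`

p2 g2's `…Fibre3ChainLimit.abs_aKer_sub_aZ2_le` gives `|a_L − aZ2| ≤ 2C₀|r|²/L` (`C₀ ≈ 221`) and the second-difference upgrade
`O(|r|² ln L/L²)` carries a constant `~5·10⁴` — far above the PROVED shell term `2|r|²(11.71 ln L + 5.9)/L²` of the near-pair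
tail.  On the WINDOW the deviation `d_L(r) := a_L(r;0) − a_∞(r)` is pinned much more sharply by two exact inputs and harmonicity:
* `d_L(0) = 0`, `d_L(1,0) = −1/(4V)` EXACTLY (`aKer_zero_axis`, `aZ2_one_zero`), `|d_L(n,n)| ≤ n²/L²` (`…DiagonalRate`);
* `dev_identity`: `Σ_e d_L(r+e) = 4d_L(r) − 1/V` off the origin (torus harmonicity `nbSum_aKer_zero` minus `aZ2_harmonic`), hence
  the forward steps `dev_step` (`|d(x+1,y)| ≤ (4A + B + C + D + 1)/L²`) and `dev_diag_step` (`|d(n+1,n)| ≤ (4A + 2D + 1)/(2L²)`,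
  by the swap symmetry `aKer_int_swap`); mirror `aKer_int_mirror_y`;
* ★★★ the table (`L ≥ 12`, units `1/L²`): `(1,0): 1/4 · (1,1): 1 · (2,0): 4 · (2,1): 3 · (2,2): 4 · (3,0): 24 · (3,1): 22 · (3,2): 12 ·
  (3,3): 9 · (4,0): 145 · (4,1): 128 · (4,2): 84 · (4,3): 31 · (4,4): 16 · (5,0): 861 · (5,1): 764 · (5,2): 508 · (5,3): 234 · (5,4): 64 · (5,5): 25`
  (`dev_one_zero … dev_five_five`; the true law is `|r|²/(4L²)`: crude by forward recursion, but `10²–10⁴×` below the generic rate and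
  below the shell term on the whole window for `ln L ≳ 4`) — the `δper` input of `…TwoHoleBSNear.dualCert_threeQuarter_near` per entry.
Prover seat `hubbard-h0-rotor-p1` g25; helper for stmt-HubbardSuperconductivity-19089 (`--supports`).
WHAT THIS IS NOT: nothing here proves superconductivity in the Hubbard model (rotor TARGET as worded stays FALSE, g15);
an explicit rate table serving ONE input (periodisation) of ONE input (HOLE₂) of ONE conditional reduction (rung 19089).
Mathlib + tree imports only; no sorry, no axioms.
-/

set_option linter.dupNamespace false
set_option autoImplicit false

noncomputable section

open scoped BigOperators
open Complex

namespace Summit.HubbardSuperconductivity.HubbardSuperconductivity.Theorems.AnisotropyChord.Transfer.Fibre3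

namespace Subsample

variable (L : ℕ) [NeZero L]

/-! ## Torus symmetries and the harmonicity identity for the deviation -/

/-- swap symmetry of the torus kernel at integer points. [folklore] -/
theorem aKer_int_swap (lam2 : ℝ) (x y : ℤ) :
    aKer L lam2 (((y : ℤ) : ZMod L), ((x : ℤ) : ZMod L)) = aKer L lam2 (((x : ℤ) : ZMod L), ((y : ℤ) : ZMod L)) := by
  unfold aKer
  rw [← Gres_swap L lam2 ((((x : ℤ) : ZMod L), ((y : ℤ) : ZMod L)) : Tor L)]

/-- mirror symmetry in the second coordinate at integer points. [folklore] -/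
theorem aKer_int_mirror_y (lam2 : ℝ) (x y : ℤ) :
    aKer L lam2 (((x : ℤ) : ZMod L), (((-y : ℤ)) : ZMod L)) = aKer L lam2 (((x : ℤ) : ZMod L), ((y : ℤ) : ZMod L)) := by
  unfold aKer
  have e : ((((x : ℤ) : ZMod L), (((-y : ℤ)) : ZMod L)) : Tor L) = -((((-x : ℤ) : ZMod L), ((y : ℤ) : ZMod L)) : Tor L) := by
    push_cast; ext <;> simp
  rw [e, Gres_neg]
  have e2 : ((((-x : ℤ) : ZMod L), ((y : ℤ) : ZMod L)) : Tor L)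
      = (-((((x : ℤ) : ZMod L), ((y : ℤ) : ZMod L)) : Tor L).1, ((((x : ℤ) : ZMod L), ((y : ℤ) : ZMod L)) : Tor L).2) := by
    push_cast; rfl
  rw [e2, Gres_mirror]

/-- ★ HARMONICITY OF THE DEVIATION `d_L = a_L(·;0) − a_∞`: off the origin (and inside the torus),
`d(x+1,y) + d(x−1,y) + d(x,y+1) + d(x,y−1) = 4d(x,y) − 1/V`. [folklore] -/
theorem dev_identity (hL : 2 ≤ L) (x y : ℤ) (hx : x.natAbs < L) (hy : y.natAbs < L) (h0 : ¬ (x = 0 ∧ y = 0)) :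
    (aKer L 0 ((((x + 1 : ℤ)) : ZMod L), ((y : ℤ) : ZMod L)) - aZ2 (x + 1) y)
      + (aKer L 0 ((((x - 1 : ℤ)) : ZMod L), ((y : ℤ) : ZMod L)) - aZ2 (x - 1) y)
      + (aKer L 0 (((x : ℤ) : ZMod L), (((y + 1 : ℤ)) : ZMod L)) - aZ2 x (y + 1))
      + (aKer L 0 (((x : ℤ) : ZMod L), (((y - 1 : ℤ)) : ZMod L)) - aZ2 x (y - 1))
      = 4 * (aKer L 0 (((x : ℤ) : ZMod L), ((y : ℤ) : ZMod L)) - aZ2 x y) - 1 / (L : ℝ) ^ 2 := by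
  have h := nbSum_aKer_zero L hL ((((x : ℤ) : ZMod L), ((y : ℤ) : ZMod L)) : Tor L)
  unfold nbSum at h
  have e1 : ((((x : ℤ) : ZMod L), ((y : ℤ) : ZMod L)) : Tor L) + ex L = ((((x + 1 : ℤ)) : ZMod L), ((y : ℤ) : ZMod L)) := by
    ext <;> simp [ex]
  have e2 : ((((x : ℤ) : ZMod L), ((y : ℤ) : ZMod L)) : Tor L) + -ex L = ((((x - 1 : ℤ)) : ZMod L), ((y : ℤ) : ZMod L)) := by
    ext <;> simp [ex, sub_eq_add_neg]
  have e3 : ((((x : ℤ) : ZMod L), ((y : ℤ) : ZMod L)) : Tor L) + ey L = (((x : ℤ) : ZMod L), (((y + 1 : ℤ)) : ZMod L)) := by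
    ext <;> simp [ey]
  have e4 : ((((x : ℤ) : ZMod L), ((y : ℤ) : ZMod L)) : Tor L) + -ey L = (((x : ℤ) : ZMod L), (((y - 1 : ℤ)) : ZMod L)) := by
    ext <;> simp [ey, sub_eq_add_neg]
  rw [e1, e2, e3, e4] at h
  have hiff := intCast_pt_eq_zero_iff L hx hy
  rw [if_neg (fun h' => h0 (hiff.mp h'))] at h
  have hz := aZ2_harmonic x y
  rw [if_neg h0, add_zero] at hz
  linarith

/-- ★ FORWARD STEP: bounds `A, B, C, D` (units `1/L²`) on `|d|` at `(x,y), (x−1,y), (x,y+1), (x,y−1)` give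
`|d(x+1,y)| ≤ (4A + B + C + D + 1)/L²` (neighbour coordinates passed explicitly, for literal instantiation). [folklore] -/
theorem dev_step (hL : 2 ≤ L) (x y xp xm yp ym : ℤ) (hxp : xp = x + 1) (hxm : xm = x - 1) (hyp : yp = y + 1)
    (hym : ym = y - 1) (hx : x.natAbs < L) (hy : y.natAbs < L) (h0 : ¬ (x = 0 ∧ y = 0)) {A B C D : ℝ}
    (hA : |aKer L 0 (((x : ℤ) : ZMod L), ((y : ℤ) : ZMod L)) - aZ2 x y| ≤ A / (L : ℝ) ^ 2)
    (hB : |aKer L 0 (((xm : ℤ) : ZMod L), ((y : ℤ) : ZMod L)) - aZ2 xm y| ≤ B / (L : ℝ) ^ 2)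
    (hC : |aKer L 0 (((x : ℤ) : ZMod L), ((yp : ℤ) : ZMod L)) - aZ2 x yp| ≤ C / (L : ℝ) ^ 2)
    (hD : |aKer L 0 (((x : ℤ) : ZMod L), ((ym : ℤ) : ZMod L)) - aZ2 x ym| ≤ D / (L : ℝ) ^ 2) :
    |aKer L 0 (((xp : ℤ) : ZMod L), ((y : ℤ) : ZMod L)) - aZ2 xp y| ≤ (4 * A + B + C + D + 1) / (L : ℝ) ^ 2 := by
  subst hxp hxm hyp hym
  have h := dev_identity L hL x y hx hy h0
  have hL0 : (0 : ℝ) < L := by exact_mod_cast (show 0 < L by omega)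
  rw [abs_le] at hA hB hC hD ⊢
  obtain ⟨hA1, hA2⟩ := hA; obtain ⟨hB1, hB2⟩ := hB; obtain ⟨hC1, hC2⟩ := hC; obtain ⟨hD1, hD2⟩ := hD
  have hV : 0 < 1 / (L : ℝ) ^ 2 := by positivity
  rw [add_div, add_div, add_div, add_div]
  rw [show 4 * A / (L : ℝ) ^ 2 = 4 * (A / (L : ℝ) ^ 2) by ring]
  constructor <;> linarith

/-- ★ DIAGONAL-NEIGHBOUR STEP (swap symmetry): bounds `A` at `(n,n)` and `D` at `(n,n−1)` give `|d(n+1,n)| ≤ (4A + 2D + 1)/(2L²)`. [folklore] -/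
theorem dev_diag_step (hL : 2 ≤ L) (n np nm : ℤ) (hnp : np = n + 1) (hnm : nm = n - 1) (hn : n.natAbs < L) (h0 : n ≠ 0)
    {A D : ℝ}
    (hA : |aKer L 0 (((n : ℤ) : ZMod L), ((n : ℤ) : ZMod L)) - aZ2 n n| ≤ A / (L : ℝ) ^ 2)
    (hD : |aKer L 0 (((n : ℤ) : ZMod L), ((nm : ℤ) : ZMod L)) - aZ2 n nm| ≤ D / (L : ℝ) ^ 2) :
    |aKer L 0 (((np : ℤ) : ZMod L), ((n : ℤ) : ZMod L)) - aZ2 np n| ≤ (4 * A + 2 * D + 1) / (2 * (L : ℝ) ^ 2) := by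
  subst hnp hnm
  have h := dev_identity L hL n n hn hn (fun h' => h0 h'.1)
  have hL0 : (0 : ℝ) < L := by exact_mod_cast (show 0 < L by omega)
  -- swap: `d(n, n+1) = d(n+1, n)`, `d(n−1, n) = d(n, n−1)`
  rw [aKer_int_swap L 0 (n + 1) n, aZ2_swap (n + 1) n, aKer_int_swap L 0 n (n - 1), ← aZ2_swap (n - 1) n] at h
  rw [abs_le] at hA hD ⊢
  obtain ⟨hA1, hA2⟩ := hA; obtain ⟨hD1, hD2⟩ := hD
  have hV : 0 < 1 / (L : ℝ) ^ 2 := by positivity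
  have e : (4 * A + 2 * D + 1) / (2 * (L : ℝ) ^ 2) = 2 * (A / (L : ℝ) ^ 2) + D / (L : ℝ) ^ 2 + (1 / (L : ℝ) ^ 2) / 2 := by
    field_simp; ring
  rw [e]
  constructor <;> linarith

/-! ## Base values: the origin, the axis point (exact), the diagonal -/

/-- `d_L(0,0) = 0`. [folklore] -/
theorem dev_zero : |aKer L 0 ((((0 : ℤ)) : ZMod L), (((0 : ℤ)) : ZMod L)) - aZ2 0 0| ≤ 0 / (L : ℝ) ^ 2 := by
  rw [aZ2_zero, zero_div]
  have : ((((0 : ℤ) : ZMod L)), (((0 : ℤ)) : ZMod L)) = (0 : Tor L) := by push_cast; rfl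
  rw [this]
  unfold aKer
  simp

/-- ★ `d_L(1,0) = −1/(4V)` exactly, so `|d_L(1,0)| ≤ (1/4)/L²` (`L ≥ 2`). [folklore] -/
theorem dev_one_zero (hL : 2 ≤ L) :
    |aKer L 0 ((((1 : ℤ)) : ZMod L), (((0 : ℤ)) : ZMod L)) - aZ2 1 0| ≤ (1 / 4) / (L : ℝ) ^ 2 := by
  have e : ((((1 : ℤ) : ZMod L)), (((0 : ℤ)) : ZMod L)) = ex L := by push_cast; rfl
  rw [e, aKer_zero_axis L hL, aZ2_one_zero]
  have hL0 : (0 : ℝ) < L := by exact_mod_cast (show 0 < L by omega)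
  rw [show (1 - 1 / (L : ℝ) ^ 2) / 4 - 1 / 4 = -((1 / 4) / (L : ℝ) ^ 2) by ring, abs_neg,
    abs_of_pos (by positivity)]

/-- `d_L(0,1) = d_L(1,0)`. [folklore] -/
theorem dev_zero_one (hL : 2 ≤ L) :
    |aKer L 0 ((((0 : ℤ)) : ZMod L), (((1 : ℤ)) : ZMod L)) - aZ2 0 1| ≤ (1 / 4) / (L : ℝ) ^ 2 := by
  rw [aKer_int_swap L 0 1 0, aZ2_swap 1 0]; exact dev_one_zero L hL

/-- ★ the diagonal: `|d_L(n,n)| ≤ n²/L²` (`2n ≤ L`), integer-cast form. [folklore] -/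
theorem dev_diag (n : ℕ) (hn : 2 * n ≤ L) :
    |aKer L 0 ((((n : ℤ)) : ZMod L), (((n : ℤ)) : ZMod L)) - aZ2 n n| ≤ (n : ℝ) ^ 2 / (L : ℝ) ^ 2 := by
  have h := abs_aKer_diag_sub_aZ2_le L n hn
  simp only [Int.cast_natCast] at h ⊢
  exact h

/-! ## The table on the window `0 ≤ y ≤ x ≤ 5` (`L ≥ 12`) -/

/-- `(1,1)`: `≤ 1/L²`. [folklore] -/
theorem dev_one_one (hL : 12 ≤ L) :
    |aKer L 0 ((((1 : ℤ)) : ZMod L), (((1 : ℤ)) : ZMod L)) - aZ2 1 1| ≤ 1 / (L : ℝ) ^ 2 := by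
  have h := dev_diag L 1 (by omega); push_cast at h ⊢; simpa using h

/-- `(2,2)`: `≤ 4/L²`. [folklore] -/
theorem dev_two_two (hL : 12 ≤ L) :
    |aKer L 0 ((((2 : ℤ)) : ZMod L), (((2 : ℤ)) : ZMod L)) - aZ2 2 2| ≤ 4 / (L : ℝ) ^ 2 := by
  have h := dev_diag L 2 (by omega); push_cast at h ⊢; norm_num at h; exact h

/-- `(3,3)`: `≤ 9/L²`. [folklore] -/
theorem dev_three_three (hL : 12 ≤ L) :
    |aKer L 0 ((((3 : ℤ)) : ZMod L), (((3 : ℤ)) : ZMod L)) - aZ2 3 3| ≤ 9 / (L : ℝ) ^ 2 := by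
  have h := dev_diag L 3 (by omega); push_cast at h ⊢; norm_num at h; exact h

/-- `(4,4)`: `≤ 16/L²`. [folklore] -/
theorem dev_four_four (hL : 12 ≤ L) :
    |aKer L 0 ((((4 : ℤ)) : ZMod L), (((4 : ℤ)) : ZMod L)) - aZ2 4 4| ≤ 16 / (L : ℝ) ^ 2 := by
  have h := dev_diag L 4 (by omega); push_cast at h ⊢; norm_num at h; exact h

/-- `(5,5)`: `≤ 25/L²`. [folklore] -/
theorem dev_five_five (hL : 12 ≤ L) :
    |aKer L 0 ((((5 : ℤ)) : ZMod L), (((5 : ℤ)) : ZMod L)) - aZ2 5 5| ≤ 25 / (L : ℝ) ^ 2 := by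
  have h := dev_diag L 5 (by omega); push_cast at h ⊢; norm_num at h; exact h

/-- `(2,0)`: `≤ 4/L²`. [folklore] -/
theorem dev_two_zero (hL : 12 ≤ L) :
    |aKer L 0 ((((2 : ℤ)) : ZMod L), (((0 : ℤ)) : ZMod L)) - aZ2 2 0| ≤ 4 / (L : ℝ) ^ 2 := by
  have hm : |aKer L 0 ((((1 : ℤ)) : ZMod L), (((-1 : ℤ)) : ZMod L)) - aZ2 1 (-1)| ≤ 1 / (L : ℝ) ^ 2 := by
    rw [show (-1 : ℤ) = -(1 : ℤ) from rfl, aKer_int_mirror_y L 0 1 1, aZ2_mirror_y 1 1]; exact dev_one_one L hL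
  have h := dev_step L (by omega) 1 0 2 0 1 (-1) (by norm_num) (by norm_num) (by norm_num) (by norm_num)
    (by norm_num; omega) (by norm_num; omega) (by norm_num) (dev_one_zero L (by omega)) (dev_zero L) (dev_one_one L hL) hm
  refine h.trans (div_le_div_of_nonneg_right (by norm_num) (by positivity))

/-- `(2,1)`: `≤ 3/L²` (diagonal-neighbour step at `(1,1)`: `(4·1 + 2·1/4 + 1)/2 ≤ 3`). [folklore] -/
theorem dev_two_one (hL : 12 ≤ L) :
    |aKer L 0 ((((2 : ℤ)) : ZMod L), (((1 : ℤ)) : ZMod L)) - aZ2 2 1| ≤ 3 / (L : ℝ) ^ 2 := by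
  have h := dev_diag_step L (by omega) 1 2 0 (by norm_num) (by norm_num) (by norm_num; omega) (by norm_num)
    (dev_one_one L hL) (dev_one_zero L (by omega))
  refine h.trans ?_
  rw [div_le_div_iff₀ (by positivity) (by positivity)]
  nlinarith

/-- `(3,0)`: `≤ 24/L²` (forward step at `(2,0)`: `4·4 + 1/4 + 3 + 3 + 1 = 23.25`). [folklore] -/
theorem dev_three_zero (hL : 12 ≤ L) :
    |aKer L 0 ((((3 : ℤ)) : ZMod L), (((0 : ℤ)) : ZMod L)) - aZ2 3 0| ≤ 24 / (L : ℝ) ^ 2 := by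
  have hm : |aKer L 0 ((((2 : ℤ)) : ZMod L), (((-1 : ℤ)) : ZMod L)) - aZ2 2 (-1)| ≤ 3 / (L : ℝ) ^ 2 := by
    rw [show (-1 : ℤ) = -(1 : ℤ) from rfl, aKer_int_mirror_y L 0 2 1, aZ2_mirror_y 2 1]; exact dev_two_one L hL
  have h := dev_step L (by omega) 2 0 3 1 1 (-1) (by norm_num) (by norm_num) (by norm_num) (by norm_num)
    (by norm_num; omega) (by norm_num; omega) (by norm_num) (dev_two_zero L hL) (dev_one_zero L (by omega)) (dev_two_one L hL) hm
  refine h.trans (div_le_div_of_nonneg_right (by norm_num) (by positivity))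

/-- `(3,1)`: `≤ 22/L²` (forward step at `(2,1)`: `4·3 + 1 + 4 + 4 + 1 = 22`). [folklore] -/
theorem dev_three_one (hL : 12 ≤ L) :
    |aKer L 0 ((((3 : ℤ)) : ZMod L), (((1 : ℤ)) : ZMod L)) - aZ2 3 1| ≤ 22 / (L : ℝ) ^ 2 := by
  have h := dev_step L (by omega) 2 1 3 1 2 0 (by norm_num) (by norm_num) (by norm_num) (by norm_num)
    (by norm_num; omega) (by norm_num; omega) (by norm_num) (dev_two_one L hL) (dev_one_one L hL) (dev_two_two L hL) (dev_two_zero L hL)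
  refine h.trans (div_le_div_of_nonneg_right (by norm_num) (by positivity))

/-- `(3,2)`: `≤ 12/L²` (diagonal-neighbour step at `(2,2)`: `(4·4 + 2·3 + 1)/2 ≤ 12`). [folklore] -/
theorem dev_three_two (hL : 12 ≤ L) :
    |aKer L 0 ((((3 : ℤ)) : ZMod L), (((2 : ℤ)) : ZMod L)) - aZ2 3 2| ≤ 12 / (L : ℝ) ^ 2 := by
  have h := dev_diag_step L (by omega) 2 3 1 (by norm_num) (by norm_num) (by norm_num; omega) (by norm_num)
    (dev_two_two L hL) (dev_two_one L hL)
  refine h.trans ?_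
  rw [div_le_div_iff₀ (by positivity) (by positivity)]
  nlinarith

/-- `(4,0)`: `≤ 145/L²` (forward step at `(3,0)`: `4·24 + 4 + 22 + 22 + 1 = 145`). [folklore] -/
theorem dev_four_zero (hL : 12 ≤ L) :
    |aKer L 0 ((((4 : ℤ)) : ZMod L), (((0 : ℤ)) : ZMod L)) - aZ2 4 0| ≤ 145 / (L : ℝ) ^ 2 := by
  have hm : |aKer L 0 ((((3 : ℤ)) : ZMod L), (((-1 : ℤ)) : ZMod L)) - aZ2 3 (-1)| ≤ 22 / (L : ℝ) ^ 2 := by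
    rw [show (-1 : ℤ) = -(1 : ℤ) from rfl, aKer_int_mirror_y L 0 3 1, aZ2_mirror_y 3 1]; exact dev_three_one L hL
  have h := dev_step L (by omega) 3 0 4 2 1 (-1) (by norm_num) (by norm_num) (by norm_num) (by norm_num)
    (by norm_num; omega) (by norm_num; omega) (by norm_num) (dev_three_zero L hL) (dev_two_zero L hL) (dev_three_one L hL) hm
  refine h.trans (div_le_div_of_nonneg_right (by norm_num) (by positivity))

/-- `(4,1)`: `≤ 128/L²` (forward step at `(3,1)`: `4·22 + 3 + 12 + 24 + 1 = 128`). [folklore] -/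
theorem dev_four_one (hL : 12 ≤ L) :
    |aKer L 0 ((((4 : ℤ)) : ZMod L), (((1 : ℤ)) : ZMod L)) - aZ2 4 1| ≤ 128 / (L : ℝ) ^ 2 := by
  have h := dev_step L (by omega) 3 1 4 2 2 0 (by norm_num) (by norm_num) (by norm_num) (by norm_num)
    (by norm_num; omega) (by norm_num; omega) (by norm_num) (dev_three_one L hL) (dev_two_one L hL) (dev_three_two L hL) (dev_three_zero L hL)
  refine h.trans (div_le_div_of_nonneg_right (by norm_num) (by positivity))

/-- `(4,2)`: `≤ 84/L²` (forward step at `(3,2)`: `4·12 + 4 + 9 + 22 + 1 = 84`). [folklore] -/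
theorem dev_four_two (hL : 12 ≤ L) :
    |aKer L 0 ((((4 : ℤ)) : ZMod L), (((2 : ℤ)) : ZMod L)) - aZ2 4 2| ≤ 84 / (L : ℝ) ^ 2 := by
  have h := dev_step L (by omega) 3 2 4 2 3 1 (by norm_num) (by norm_num) (by norm_num) (by norm_num)
    (by norm_num; omega) (by norm_num; omega) (by norm_num) (dev_three_two L hL) (dev_two_two L hL) (dev_three_three L hL) (dev_three_one L hL)
  refine h.trans (div_le_div_of_nonneg_right (by norm_num) (by positivity))

/-- `(4,3)`: `≤ 31/L²` (diagonal-neighbour step at `(3,3)`: `(4·9 + 2·12 + 1)/2 ≤ 31`). [folklore] -/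
theorem dev_four_three (hL : 12 ≤ L) :
    |aKer L 0 ((((4 : ℤ)) : ZMod L), (((3 : ℤ)) : ZMod L)) - aZ2 4 3| ≤ 31 / (L : ℝ) ^ 2 := by
  have h := dev_diag_step L (by omega) 3 4 2 (by norm_num) (by norm_num) (by norm_num; omega) (by norm_num)
    (dev_three_three L hL) (dev_three_two L hL)
  refine h.trans ?_
  rw [div_le_div_iff₀ (by positivity) (by positivity)]
  nlinarith

/-- `(5,0)`: `≤ 861/L²` (forward step at `(4,0)`: `4·145 + 24 + 128 + 128 + 1 = 861`). [folklore] -/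
theorem dev_five_zero (hL : 12 ≤ L) :
    |aKer L 0 ((((5 : ℤ)) : ZMod L), (((0 : ℤ)) : ZMod L)) - aZ2 5 0| ≤ 861 / (L : ℝ) ^ 2 := by
  have hm : |aKer L 0 ((((4 : ℤ)) : ZMod L), (((-1 : ℤ)) : ZMod L)) - aZ2 4 (-1)| ≤ 128 / (L : ℝ) ^ 2 := by
    rw [show (-1 : ℤ) = -(1 : ℤ) from rfl, aKer_int_mirror_y L 0 4 1, aZ2_mirror_y 4 1]; exact dev_four_one L hL
  have h := dev_step L (by omega) 4 0 5 3 1 (-1) (by norm_num) (by norm_num) (by norm_num) (by norm_num)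
    (by norm_num; omega) (by norm_num; omega) (by norm_num) (dev_four_zero L hL) (dev_three_zero L hL) (dev_four_one L hL) hm
  refine h.trans (div_le_div_of_nonneg_right (by norm_num) (by positivity))

/-- `(5,1)`: `≤ 764/L²` (forward step at `(4,1)`: `4·128 + 22 + 84 + 145 + 1 = 764`). [folklore] -/
theorem dev_five_one (hL : 12 ≤ L) :
    |aKer L 0 ((((5 : ℤ)) : ZMod L), (((1 : ℤ)) : ZMod L)) - aZ2 5 1| ≤ 764 / (L : ℝ) ^ 2 := by
  have h := dev_step L (by omega) 4 1 5 3 2 0 (by norm_num) (by norm_num) (by norm_num) (by norm_num)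
    (by norm_num; omega) (by norm_num; omega) (by norm_num) (dev_four_one L hL) (dev_three_one L hL) (dev_four_two L hL) (dev_four_zero L hL)
  refine h.trans (div_le_div_of_nonneg_right (by norm_num) (by positivity))

/-- `(5,2)`: `≤ 508/L²` (forward step at `(4,2)`: `4·84 + 12 + 31 + 128 + 1 = 508`). [folklore] -/
theorem dev_five_two (hL : 12 ≤ L) :
    |aKer L 0 ((((5 : ℤ)) : ZMod L), (((2 : ℤ)) : ZMod L)) - aZ2 5 2| ≤ 508 / (L : ℝ) ^ 2 := by
  have h := dev_step L (by omega) 4 2 5 3 3 1 (by norm_num) (by norm_num) (by norm_num) (by norm_num)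
    (by norm_num; omega) (by norm_num; omega) (by norm_num) (dev_four_two L hL) (dev_three_two L hL) (dev_four_three L hL) (dev_four_one L hL)
  refine h.trans (div_le_div_of_nonneg_right (by norm_num) (by positivity))

/-- `(5,3)`: `≤ 234/L²` (forward step at `(4,3)`: `4·31 + 9 + 16 + 84 + 1 = 234`). [folklore] -/
theorem dev_five_three (hL : 12 ≤ L) :
    |aKer L 0 ((((5 : ℤ)) : ZMod L), (((3 : ℤ)) : ZMod L)) - aZ2 5 3| ≤ 234 / (L : ℝ) ^ 2 := by
  have h := dev_step L (by omega) 4 3 5 3 4 2 (by norm_num) (by norm_num) (by norm_num) (by norm_num)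
    (by norm_num; omega) (by norm_num; omega) (by norm_num) (dev_four_three L hL) (dev_three_three L hL) (dev_four_four L hL) (dev_four_two L hL)
  refine h.trans (div_le_div_of_nonneg_right (by norm_num) (by positivity))

/-- `(5,4)`: `≤ 64/L²` (diagonal-neighbour step at `(4,4)`: `(4·16 + 2·31 + 1)/2 ≤ 64`). [folklore] -/
theorem dev_five_four (hL : 12 ≤ L) :
    |aKer L 0 ((((5 : ℤ)) : ZMod L), (((4 : ℤ)) : ZMod L)) - aZ2 5 4| ≤ 64 / (L : ℝ) ^ 2 := by
  have h := dev_diag_step L (by omega) 4 5 3 (by norm_num) (by norm_num) (by norm_num; omega) (by norm_num)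
    (dev_four_four L hL) (dev_four_three L hL)
  refine h.trans ?_
  rw [div_le_div_iff₀ (by positivity) (by positivity)]
  nlinarith

end Subsample

end Summit.HubbardSuperconductivity.HubbardSuperconductivity.Theorems.AnisotropyChord.Transfer.Fibre3

end
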